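import Literature.MathematicalPhysics.QuantumFieldTheory.Balaban1983to89.B9Eq352ScalarFluct
import Mathlib.Analysis.SpecialFunctions.Exponential
import Mathlib.MeasureTheory.Integral.IntervalIntegral.FundThmCalculus

/-!
# `Balaban1983to89.B9Eq351RemainderIntegral` — B9 p. 400, the line after (3.51): the INTEGRAL FORM of the second-order remainder
# «F′_{1,k}(z) = η⁻²(e^{ηz} − 1 − ηz) = z²∫₀¹dt(1 − t)e^{ηtz}» PROVED at `z = iad_{A′(b)}`, together with the operator identity
# `e^{b}Xe^{−b} = (exp ad_b)(X)` («R(U′) = exp ηiad_A», p. 405) that gives `e^{ηtz}` its meaning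

HONEST FRAMING (cell `lit-balaban`, verbatim): statement-level skeleton of published theorems with citation tags; proofs
where landed; nothing here is a claim about the Yang–Mills mass gap.

CITATION HEADER (lean-in-tree rule).  T. Bałaban, *Propagators for lattice gauge theories in a background field*, Commun.
Math. Phys. **99** (1985) 389–434 [`Balaban1985BackgroundPropagators`] (cell paper B9; held `paper:balaban1985-cmp99-background-propagators`,
journal page = PDF page + 388), p. 400 [PDF 12] (3.50)–(3.53) and p. 405 [PDF 17]; read by this seat (r06 gen 22, 2026-08-23) in the
held text layer (p0012) against the render `b2b-balaban-ref1/pages/1985-cmp99-background-propagators/…-p012-x2.png`.  Cell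
`lit-balaban`, seat r06 (B9 fold owner), SKELETON row `B9.Eq3.50` ((3.50)–(3.53)); companion of `B9Eq352ScalarFluct` (p239133:
`siteLap`, `Fp1`, `V1p`, `eq353`), `B9Eq352DivForm` (p260065) and `B9Eq352Analytic` (p359018: «hence F′_{1,k}(iad_{A′(b)}) is an
analytic function of A′(b)» proved).  THEOREMS ONLY (no `def`, no `Prop` fact); 0 sorry.

WHAT IS PRINTED (p. 400, verbatim «…»).  After the expansion (3.51) of `Δ_{U′U}`: «where F′_{1,k}(z) = η⁻²(e^{ηz} − 1 − ηz) =
z²∫₀¹dt(1 − t)e^{ηtz}, hence F′_{1,k}(iad_{A′(b)}) is an analytic function of A′(b).»  In (3.51)/(3.52) the letter is used at the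
operator argument `z = iad_{A′(b)}` acting on `λ(b₊)` («Σ_{b∈st(x)} F′_{1,k}(iad_{A′(b)})λ(b₊)»); p. 405: «R(U′) = exp ηiad_A = 1 +
ηiad_A + ⋯».  The tree's letter (`B9Eq352ScalarFluct.Fp1 η a Y = η⁻²·𝓕(iηa, Y)`, `𝓕(b, X) = e^{b}Xe^{−b} − X − [b, X]` =
`B9Eq370Expansion.conjRem`) IS the first equality read at `z = iad_a` through «R(e^{iηa}) = exp ηiad_a»; the SECOND equality (the
integral form) and that reading itself were not in the tree («the identity Ad∘exp = exp∘ad is not formalised», header of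
`B9Eq370Expansion`).  Both are proved here.

WHAT THIS FILE PROVES (kernel-checked; `𝔸` any complete normed `ℂ`-algebra ⊇ print's matrix algebras; `t` a REAL parameter,
`t • b` the real scalar action).
* §1 `exp_sub_one_sub_eq_integral`: `e^{w} − 1 − w = ∫₀¹ (1 − t)·e^{tw}w² dt` (Taylor at order two with integral remainder, by the
  fundamental theorem of calculus on `g(t) = e^{tw} + (1 − t)e^{tw}w`); `Fscalar_eq_integral`: for `η ≠ 0`,
  `η⁻²(e^{ηz} − 1 − ηz) = ∫₀¹ (1 − t)·e^{ηtz}z² dt` — the printed scalar identity for an ELEMENT `z`.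
* §2 `hasDerivAt_conj` (`d/dt e^{tb}Xe^{−tb} = ad_b(e^{tb}Xe^{−tb})`), `hasDerivAt_ad_conj`, `continuous_conj`, and
  **`conjRem_eq_integral`**: `e^{b}Xe^{−b} − X − [b, X] = ∫₀¹ (1 − t)·ad_b(ad_b(e^{tb}Xe^{−tb})) dt`.
* §3 **`Fp1_eq_integral`** (`η ≠ 0`): `F′_{1,k}(iad_a)Y = −∫₀¹ (1 − t)·ad_a(ad_a(e^{t·iηa}Ye^{−t·iηa})) dt` — the printed
  `z²∫₀¹dt(1 − t)e^{ηtz}Y` with `z² = (iad_a)² = −ad_a²` and `e^{ηtz}Y = e^{iηta}Ye^{−iηta}`; `Fp1_eq_ad_ad_integral`: the same with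
  `ad_a∘ad_a` OUTSIDE the Bochner integral (bounded operators commute with it).
* §4 **`conj_eq_exp_ad`**: `e^{b}Xe^{−b} = exp(ad_b)(X)`, `ad_b = L_b − R_b ∈ 𝔸 →L[ℝ] 𝔸` (`ContinuousLinearMap.mul`), the
  exponential taken in that Banach algebra (proof: `t ↦ exp(−t·ad_b)(e^{tb}Xe^{−tb})` has zero derivative); `conj_smul_eq_exp_ad`:
  `e^{tb}Xe^{−tb} = exp(t·ad_b)(X)`.
* §5 **`Fp1_eq_printed`** (`η ≠ 0`): the printed line assembled letter for letter —
  `F′_{1,k}(iad_a)Y = −ad_a(ad_a(∫₀¹ (1 − t)·exp(t·ad_{iηa})Y dt))`, i.e. `z²∫₀¹dt(1 − t)e^{ηtz}` applied to `Y` at `z = iad_a`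
  (`ηt·iad_a = t·ad_{iηa}`).
HONEST SCOPE.  `η ≠ 0` is print's regime (`η = L^{−k}`); at `η = 0` the tree's `Fp1` is `0` by the `η⁻²` convention while the
integral is `−½ad_a²Y`, so the hypothesis is needed.  The operator exponential is over `ℝ` (the parameter `t` is real; `exp` does not
depend on the scalar field).  Nothing here bounds `F′_{1,k}` (the tree's bound is `B9Eq370Expansion.norm_conjRem_le`); nothing is
inferred from the manuscript beyond the displayed identities.
-/

namespace Literature.MathematicalPhysics.QuantumFieldTheory.Balaban1983to89.B9Eq351RemainderIntegral

open NormedSpace Complex MeasureTheory intervalIntegral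
open Literature.MathematicalPhysics.QuantumFieldTheory.Balaban1983to89
open Literature.MathematicalPhysics.QuantumFieldTheory.Balaban1983to89.Beta.BackgroundVertices (ad ad_apply ad_smul_left ad_smul_right)
open Literature.MathematicalPhysics.QuantumFieldTheory.Balaban1983to89.B9Eq370Expansion (conjRem)
open Literature.MathematicalPhysics.QuantumFieldTheory.Balaban1983to89.B9Eq352ScalarFluct (Fp1 Fp1_eq)

variable {𝔸 : Type*} [NormedRing 𝔸] [NormedAlgebra ℂ 𝔸] [CompleteSpace 𝔸]

/-! ## §1 The scalar Taylor formula with integral remainder: `e^{w} − 1 − w = ∫₀¹ (1 − t) w² e^{tw} dt` -/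

section Scalar

/-- `d/dt e^{tw} = e^{tw}·w` for a real parameter `t` (Mathlib's `hasDerivAt_exp_smul_const` over `ℝ`). [folklore] -/
private theorem hasDerivAt_exp_smul (w : 𝔸) (t : ℝ) :
    HasDerivAt (fun s : ℝ => exp (s • w)) (exp (t • w) * w) t :=
  hasDerivAt_exp_smul_const (𝕂 := ℝ) w t

/-- `d/dt (w·e^{tw}) = w²·e^{tw}`… in the form `e^{tw}·w·w`. [folklore] -/
private theorem hasDerivAt_exp_smul_mul (w : 𝔸) (t : ℝ) :
    HasDerivAt (fun s : ℝ => exp (s • w) * w) (exp (t • w) * w * w) t :=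
  (hasDerivAt_exp_smul w t).mul_const w

/-- The auxiliary function `g(t) = e^{tw} + (1 − t)·e^{tw}w` has derivative `(1 − t)·e^{tw}w²`. [folklore] -/
private theorem hasDerivAt_aux_scalar (w : 𝔸) (t : ℝ) :
    HasDerivAt (fun s : ℝ => exp (s • w) + (1 - s) • (exp (s • w) * w)) ((1 - t) • (exp (t • w) * w * w)) t := by
  have h1 := hasDerivAt_exp_smul w t
  have h2 := hasDerivAt_exp_smul_mul w t
  have h3 : HasDerivAt (fun s : ℝ => (1:ℝ) - s) (-1) t := by
    simpa using (hasDerivAt_id t).const_sub (1:ℝ)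
  have h4 : HasDerivAt (fun s : ℝ => exp (s • w) + (1 - s) • (exp (s • w) * w))
      (exp (t • w) * w + ((1 - t) • (exp (t • w) * w * w) + (-1 : ℝ) • (exp (t • w) * w))) t :=
    h1.add (h3.smul h2)
  refine h4.congr_deriv ?_
  rw [neg_one_smul]; abel

/-- **Taylor's formula with integral remainder at second order for the exponential** of a complete normed algebra:
`e^{w} − 1 − w = ∫₀¹ (1 − t)·e^{tw}w² dt`. [folklore] [cite: Balaban1985BackgroundPropagators, p.400 (line after (3.51))] -/
theorem exp_sub_one_sub_eq_integral (w : 𝔸) :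
    exp w - 1 - w = ∫ t in (0:ℝ)..1, (1 - t) • (exp (t • w) * w * w) := by
  have hint : IntervalIntegrable (fun t : ℝ => (1 - t) • (exp (t • w) * w * w)) volume 0 1 := by
    apply Continuous.intervalIntegrable
    have hc : Continuous fun s : ℝ => exp (s • w) :=
      continuous_iff_continuousAt.2 fun s => (hasDerivAt_exp_smul w s).continuousAt
    exact (continuous_const.sub continuous_id).smul ((hc.mul continuous_const).mul continuous_const)
  have h := intervalIntegral.integral_eq_sub_of_hasDerivAt (fun t _ => hasDerivAt_aux_scalar w t) hint
  rw [h]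
  simp only [one_smul, sub_self, zero_smul, add_zero, NormedSpace.exp_zero, one_mul, sub_zero]
  abel

/-- The printed scalar form: for `η ≠ 0`, `η⁻²(e^{ηz} − 1 − ηz) = z² ∫₀¹ dt (1 − t) e^{ηtz}` — here with the power `z²` written to
the right of the exponential inside the integral (all three commute). [cite: Balaban1985BackgroundPropagators, p.400 (line after (3.51))] -/
theorem Fscalar_eq_integral {η : ℝ} (hη : η ≠ 0) (z : 𝔸) :
    ((η : ℂ)⁻¹) ^ 2 • (exp ((η : ℂ) • z) - 1 - (η : ℂ) • z)
      = ∫ t in (0:ℝ)..1, (1 - t) • (exp ((t * η : ℝ) • z) * z * z) := by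
  have h := exp_sub_one_sub_eq_integral ((η : ℂ) • z)
  have hfun : (fun t : ℝ => (1 - t) • (exp (t • ((η : ℂ) • z)) * ((η : ℂ) • z) * ((η : ℂ) • z)))
      = fun t : ℝ => ((η : ℂ) * (η : ℂ)) • ((1 - t) • (exp ((t * η : ℝ) • z) * z * z)) := by
    funext t
    have e1 : t • ((η : ℂ) • z) = (t * η : ℝ) • z := by
      rw [← Complex.coe_smul, smul_smul, ← Complex.ofReal_mul, Complex.coe_smul]
    rw [e1]
    simp only [mul_smul_comm, smul_mul_assoc, smul_smul]
    rw [smul_comm]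
  rw [hfun, intervalIntegral.integral_smul] at h
  rw [h, smul_smul]
  have : ((η : ℂ)⁻¹) ^ 2 * ((η : ℂ) * (η : ℂ)) = 1 := by
    have hη' : (η : ℂ) ≠ 0 := Complex.ofReal_ne_zero.2 hη
    field_simp
  rw [this, one_smul]

end Scalar

/-! ## §2 The conjugation orbit `t ↦ e^{tb}Xe^{−tb}` and the integral form of `𝓕(b, X) = e^{b}Xe^{−b} − X − [b, X]` -/

section Conj

/-- `d/dt (e^{tb}Xe^{−tb}) = ad_b(e^{tb}Xe^{−tb})` (real parameter `t`; `b` commutes with `e^{±tb}`).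
[folklore] [cite: Balaban1985BackgroundPropagators, p.405 («R(U′) = exp ηiad_A»)] -/
theorem hasDerivAt_conj (b X : 𝔸) (t : ℝ) :
    HasDerivAt (fun s : ℝ => exp (s • b) * X * exp (s • (-b))) (ad b (exp (t • b) * X * exp (t • (-b)))) t := by
  have h1 := hasDerivAt_exp_smul_const (𝕂 := ℝ) b t
  have h2 := hasDerivAt_exp_smul_const' (𝕂 := ℝ) (-b) t
  have h : HasDerivAt (fun s : ℝ => exp (s • b) * X * exp (s • (-b)))
      (exp (t • b) * b * X * exp (t • (-b)) + exp (t • b) * X * (-b * exp (t • (-b)))) t :=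
    (h1.mul_const X).mul h2
  refine h.congr_deriv ?_
  have hc1 : exp (t • b) * b = b * exp (t • b) := (((Commute.refl b).smul_right t).exp_right).eq.symm
  have hc2 : -b * exp (t • (-b)) = exp (t • (-b)) * (-b) := (((Commute.refl (-b)).smul_right t).exp_right).eq
  rw [hc1, hc2, ad_apply]
  noncomm_ring

/-- the second derivative: `d/dt ad_b(e^{tb}Xe^{−tb}) = ad_b²(e^{tb}Xe^{−tb})`. [folklore] -/
private theorem hasDerivAt_ad_conj (b X : 𝔸) (t : ℝ) :
    HasDerivAt (fun s : ℝ => ad b (exp (s • b) * X * exp (s • (-b))))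
      (ad b (ad b (exp (t • b) * X * exp (t • (-b))))) t := by
  have h := hasDerivAt_conj b X t
  have h' : HasDerivAt (fun s : ℝ => b * (exp (s • b) * X * exp (s • (-b))) - exp (s • b) * X * exp (s • (-b)) * b)
      (b * ad b (exp (t • b) * X * exp (t • (-b))) - ad b (exp (t • b) * X * exp (t • (-b))) * b) t :=
    (h.const_mul b).sub (h.mul_const b)
  simpa only [ad_apply] using h'

/-- the orbit is continuous. [folklore] -/
private theorem continuous_conj (b X : 𝔸) : Continuous fun s : ℝ => exp (s • b) * X * exp (s • (-b)) :=
  continuous_iff_continuousAt.2 fun s => (hasDerivAt_conj b X s).continuousAt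

/-- The auxiliary function `g(t) = φ(t) + (1 − t)·ad_b φ(t)`, `φ(t) = e^{tb}Xe^{−tb}`, has derivative `(1 − t)·ad_b² φ(t)`. [folklore] -/
private theorem hasDerivAt_aux_conj (b X : 𝔸) (t : ℝ) :
    HasDerivAt (fun s : ℝ => exp (s • b) * X * exp (s • (-b)) + (1 - s) • ad b (exp (s • b) * X * exp (s • (-b))))
      ((1 - t) • ad b (ad b (exp (t • b) * X * exp (t • (-b))))) t := by
  have h1 := hasDerivAt_conj b X t
  have h2 := hasDerivAt_ad_conj b X t
  have h3 : HasDerivAt (fun s : ℝ => (1:ℝ) - s) (-1) t := by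
    simpa using (hasDerivAt_id t).const_sub (1:ℝ)
  have h4 : HasDerivAt
      (fun s : ℝ => exp (s • b) * X * exp (s • (-b)) + (1 - s) • ad b (exp (s • b) * X * exp (s • (-b))))
      (ad b (exp (t • b) * X * exp (t • (-b)))
        + ((1 - t) • ad b (ad b (exp (t • b) * X * exp (t • (-b)))) + (-1 : ℝ) • ad b (exp (t • b) * X * exp (t • (-b))))) t :=
    h1.add (h3.smul h2)
  refine h4.congr_deriv ?_
  rw [neg_one_smul]; abel

/-- **THE INTEGRAL FORM OF THE CONJUGATION REMAINDER** (Taylor at second order along the orbit `t ↦ e^{tb}Xe^{−tb}`):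
`e^{b}Xe^{−b} − X − [b, X] = ∫₀¹ (1 − t)·ad_b²(e^{tb}Xe^{−tb}) dt`, i.e. `B9Eq370Expansion.conjRem b X` — the remainder print
expands on p. 405 («R(U′) = exp ηiad_A = 1 + ηiad_A + ⋯») — in closed form. [folklore]
[cite: Balaban1985BackgroundPropagators, p.400 (line after (3.51)), p.405] -/
theorem conjRem_eq_integral (b X : 𝔸) :
    conjRem b X = ∫ t in (0:ℝ)..1, (1 - t) • ad b (ad b (exp (t • b) * X * exp (t • (-b)))) := by
  have hint : IntervalIntegrable (fun t : ℝ => (1 - t) • ad b (ad b (exp (t • b) * X * exp (t • (-b))))) volume 0 1 := by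
    apply Continuous.intervalIntegrable
    have hc := continuous_conj b X
    refine (continuous_const.sub continuous_id).smul ?_
    simp only [ad_apply]
    fun_prop
  have h := intervalIntegral.integral_eq_sub_of_hasDerivAt (fun t _ => hasDerivAt_aux_conj b X t) hint
  rw [h]
  simp only [one_smul, sub_self, zero_smul, add_zero, smul_neg, NormedSpace.exp_zero, one_mul, mul_one, sub_zero, neg_zero,
    conjRem]
  abel

end Conj

/-! ## §3 (3.51): `F′_{1,k}(iad_{A′(b)}) = η⁻²(e^{ηz} − 1 − ηz)|_{z = iad} = z²∫₀¹dt(1 − t)e^{ηtz}|_{z = iad}` -/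

section Fp1

/-- **B9 (3.51), THE PRINTED INTEGRAL FORM OF `F′_{1,k}`**: for `η ≠ 0` the letter `F′_{1,k}(iad_{a})Y = η⁻²(e^{iηa}Ye^{−iηa} − Y −
iη[a, Y])` of `B9Eq352ScalarFluct.Fp1` equals `z²∫₀¹dt (1 − t) e^{ηtz}Y` at `z = i ad_a`, where `e^{ηt·iad_a}Y = e^{iηta}Ye^{−iηta}`
(print's «R(e^{iηA}) = exp ηiad_A», p. 405) and `z² = (i ad_a)² = −ad_a²`:
`F′_{1,k}(iad_a)Y = −∫₀¹ (1 − t)·ad_a(ad_a(e^{t·iηa} Y e^{−t·iηa})) dt`. [cite: Balaban1985BackgroundPropagators, (3.51) p.400 («where F′_{1,k}(z) = η⁻²(e^{ηz} − 1 − ηz) = z²∫₀¹dt(1 − t)e^{ηtz}»)] -/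
theorem Fp1_eq_integral {η : ℝ} (hη : η ≠ 0) (a Y : 𝔸) :
    Fp1 η a Y = -∫ t in (0:ℝ)..1, (1 - t) • ad a (ad a
      (exp (t • (((I * η : ℂ)) • a)) * Y * exp (t • (-(((I * η : ℂ)) • a))))) := by
  rw [Fp1_eq, conjRem_eq_integral]
  have hfun : (fun t : ℝ => (1 - t) • ad (((I * η : ℂ)) • a) (ad (((I * η : ℂ)) • a)
        (exp (t • (((I * η : ℂ)) • a)) * Y * exp (t • (-(((I * η : ℂ)) • a))))))
      = fun t : ℝ => ((I * η : ℂ) * (I * η : ℂ)) • ((1 - t) • ad a (ad a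
        (exp (t • (((I * η : ℂ)) • a)) * Y * exp (t • (-(((I * η : ℂ)) • a)))))) := by
    funext t
    rw [ad_smul_left, ad_smul_left, ad_smul_right, smul_smul, smul_comm]
  have hη' : (η : ℂ) ≠ 0 := Complex.ofReal_ne_zero.2 hη
  have hc : ((η : ℂ)⁻¹) ^ 2 * ((I * η : ℂ) * (I * η : ℂ)) = -1 := by
    rw [show (I * (η : ℂ)) * (I * η) = I ^ 2 * (η : ℂ) ^ 2 by ring, I_sq]
    field_simp
  rw [hfun, intervalIntegral.integral_smul, smul_smul, hc, neg_one_smul]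

/-- The same with the Lie square OUTSIDE the integral, literally `z²∫₀¹dt(1 − t)e^{ηtz}` applied to `Y`:
`F′_{1,k}(iad_a)Y = −ad_a(ad_a(∫₀¹ (1 − t)·e^{t·iηa} Y e^{−t·iηa} dt))` (the bounded operator `ad_a` commutes with the Bochner
integral). [cite: Balaban1985BackgroundPropagators, (3.51) p.400] -/
theorem Fp1_eq_ad_ad_integral {η : ℝ} (hη : η ≠ 0) (a Y : 𝔸) :
    Fp1 η a Y = -ad a (ad a (∫ t in (0:ℝ)..1, (1 - t) •
      (exp (t • (((I * η : ℂ)) • a)) * Y * exp (t • (-(((I * η : ℂ)) • a)))))) := by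
  rw [Fp1_eq_integral hη]
  set φ : ℝ → 𝔸 := fun t => (1 - t) • (exp (t • (((I * η : ℂ)) • a)) * Y * exp (t • (-(((I * η : ℂ)) • a)))) with hφ
  have hcont : Continuous φ := (continuous_const.sub continuous_id).smul (continuous_conj _ Y)
  have hint : IntervalIntegrable φ volume 0 1 := hcont.intervalIntegrable 0 1
  -- `ad a` as a continuous linear map over `ℝ`: `L = mul a − mulRight a`
  let L : 𝔸 →L[ℝ] 𝔸 := ContinuousLinearMap.mul ℝ 𝔸 a - (ContinuousLinearMap.mul ℝ 𝔸).flip a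
  have hL : ∀ Z, L Z = ad a Z := fun Z => by simp [L, ad_apply]
  have hLL : (fun t : ℝ => (1 - t) • ad a (ad a (exp (t • (((I * η : ℂ)) • a)) * Y * exp (t • (-(((I * η : ℂ)) • a))))))
      = fun t : ℝ => L (L (φ t)) := by
    funext t
    rw [hL, hL, hφ]
    simp only [ad_smul_right]
  have hint2 : IntervalIntegrable (fun t : ℝ => L (φ t)) volume 0 1 := (L.continuous.comp hcont).intervalIntegrable 0 1
  rw [hLL, ContinuousLinearMap.intervalIntegral_comp_comm L hint2, ContinuousLinearMap.intervalIntegral_comp_comm L hint, hL, hL]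

end Fp1

/-! ## §4 «R(U′) = exp ηiad_A» (p. 405): conjugation by `e^{b}` IS the operator exponential of `ad_b` -/

section ExpAd

/-- **`Ad ∘ exp = exp ∘ ad`**: `e^{b}Xe^{−b} = (exp ad_b)(X)`, with `ad_b = L_b − R_b` the bounded (real-linear) operator
`X ↦ bX − Xb` on `𝔸` (`ContinuousLinearMap.mul ℝ 𝔸`), its exponential taken in the Banach algebra `𝔸 →L[ℝ] 𝔸` — print's
«R(U′) = exp ηiad_A» (p. 405) and the meaning of `e^{ηtz}`, `z = iad_{A′(b)}`, in the line after (3.51); the identity the header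
of `B9Eq370Expansion` names as «not formalised».  Proof: `t ↦ exp(−t·ad_b)(e^{tb}Xe^{−tb})` has derivative zero. [folklore]
[cite: Balaban1985BackgroundPropagators, p.405, (3.51) p.400] -/
theorem conj_eq_exp_ad (b X : 𝔸) :
    exp b * X * exp (-b) = NormedSpace.exp (ContinuousLinearMap.mul ℝ 𝔸 b - (ContinuousLinearMap.mul ℝ 𝔸).flip b) X := by
  letI : NormedAlgebra ℚ (𝔸 →L[ℝ] 𝔸) := NormedAlgebra.restrictScalars ℚ ℝ (𝔸 →L[ℝ] 𝔸)
  set M : 𝔸 →L[ℝ] 𝔸 := ContinuousLinearMap.mul ℝ 𝔸 b - (ContinuousLinearMap.mul ℝ 𝔸).flip b with hM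
  have hMap : ∀ Z, M Z = ad b Z := fun Z => by simp [hM, ad_apply]
  have hE : ∀ t : ℝ, HasDerivAt (fun s : ℝ => NormedSpace.exp (s • (-M))) (NormedSpace.exp (t • (-M)) * (-M)) t :=
    fun t => hasDerivAt_exp_smul_const (𝕂 := ℝ) (-M) t
  have hψ : ∀ t : ℝ, HasDerivAt (fun s : ℝ => NormedSpace.exp (s • (-M)) (exp (s • b) * X * exp (s • (-b)))) 0 t := by
    intro t
    have h := (hE t).clm_apply (hasDerivAt_conj b X t)
    refine h.congr_deriv ?_
    rw [← hMap]
    change NormedSpace.exp (t • (-M)) ((-M) (exp (t • b) * X * exp (t • (-b))))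
        + NormedSpace.exp (t • (-M)) (M (exp (t • b) * X * exp (t • (-b)))) = 0
    rw [← map_add]
    simp
  have hconst := is_const_of_deriv_eq_zero
    (f := fun s : ℝ => NormedSpace.exp (s • (-M)) (exp (s • b) * X * exp (s • (-b))))
    (fun t => (hψ t).differentiableAt) (fun t => (hψ t).deriv) 0 1
  have h1 : X = NormedSpace.exp (-M) (exp b * X * exp (-b)) := by simpa using hconst
  have hinv : NormedSpace.exp M * NormedSpace.exp (-M) = 1 := by
    rw [← NormedSpace.exp_add_of_commute ((Commute.refl M).neg_right), add_neg_cancel, NormedSpace.exp_zero]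
  calc exp b * X * exp (-b) = (NormedSpace.exp M * NormedSpace.exp (-M)) (exp b * X * exp (-b)) := by
        rw [hinv]; rfl
    _ = NormedSpace.exp M (NormedSpace.exp (-M) (exp b * X * exp (-b))) := rfl
    _ = NormedSpace.exp M X := by rw [← h1]

/-- Hence the orbit of §2–§3 is `e^{tb}Xe^{−tb} = exp(t·ad_b)(X)` for every real `t` — the «e^{ηtz}», `z = iad_{A′(b)}`, of the
printed integral, at `b = iηA′(b)`. [cite: Balaban1985BackgroundPropagators, (3.51) p.400, p.405] -/
theorem conj_smul_eq_exp_ad (b X : 𝔸) (t : ℝ) :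
    exp (t • b) * X * exp (t • (-b))
      = NormedSpace.exp (t • (ContinuousLinearMap.mul ℝ 𝔸 b - (ContinuousLinearMap.mul ℝ 𝔸).flip b)) X := by
  rw [smul_neg, conj_eq_exp_ad (t • b) X]
  congr 2
  ext Z
  simp [smul_sub]

end ExpAd

/-! ## §5 The printed line, assembled: `F′_{1,k}(iad_a) = z²∫₀¹dt(1 − t)e^{ηtz}`, `z = iad_a`, `e^{ηtz} = exp(t·ad_{iηa})` -/

section Printed

/-- **B9 p. 400, the line after (3.51), AS PRINTED**: «F′_{1,k}(z) = η⁻²(e^{ηz} − 1 − ηz) = z²∫₀¹dt(1 − t)e^{ηtz}» at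
`z = iad_{a}` (`a = A′(b)`), with every letter an operator: `F′_{1,k}(iad_a)Y` is `B9Eq352ScalarFluct.Fp1 η a Y` (the first
equality, by definition via `B9Eq370Expansion.conjRem`), `e^{ηtz}` is the operator exponential `exp(t·ad_{iηa})` in `𝔸 →L[ℝ] 𝔸`
(§4: `= Y ↦ e^{t·iηa}Ye^{−t·iηa}`), and `z² = (iad_a)² = −ad_a∘ad_a`; valid for `η ≠ 0` (print: `η = L^{−k}`).
[cite: Balaban1985BackgroundPropagators, (3.51) p.400] -/
theorem Fp1_eq_printed {η : ℝ} (hη : η ≠ 0) (a Y : 𝔸) :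
    Fp1 η a Y = -ad a (ad a (∫ t in (0:ℝ)..1, (1 - t) •
      NormedSpace.exp (t • (ContinuousLinearMap.mul ℝ 𝔸 (((I * η : ℂ)) • a)
        - (ContinuousLinearMap.mul ℝ 𝔸).flip (((I * η : ℂ)) • a))) Y)) := by
  rw [Fp1_eq_ad_ad_integral hη]
  congr 3
  refine intervalIntegral.integral_congr fun t _ => ?_
  rw [conj_smul_eq_exp_ad]

end Printed

end Literature.MathematicalPhysics.QuantumFieldTheory.Balaban1983to89.B9Eq351RemainderIntegral
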